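import Summits.FinalStateConjecture.FinalStateConjecture.Theorems.BartnikGapSettlingGapExhaustionKerrEscapeFieldsUniform
import Summits.FinalStateConjecture.FinalStateConjecture.Theorems.BartnikGapSettlingGapExhaustionDocLocalisationOfEscape
import HarnessLib

/-!
# Crux `GapExhaustion` (stmt-FinalStateConjecture-10808), line `photon-shell-pseudoconvexity`:
# stub (UD) `stub_docLocalisationU` — the label-UNIFORM localisation of the domain of outer
# communications: ONE `C¹`-tolerance `δ > 0` for all Kerr labels `ℓ = (M, a)` of a compact set
# `K ⊆ {0 < M, |a| < M}` such that the band `{r₊(ℓ) + η ≤ r ≤ R(ℓ)}` of every chart `δ`-close to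
# the Kerr–Schild form `g_ℓ` lies in the chronological past of the far zone `{r > R(ℓ)}`
# (§1f of the line; lead c11, label-uniformity wave 2)

Route `BartnikGapSettling`; helper (`--supports stmt-FinalStateConjecture-10808`). The registered
outward Killing sweep S5 quantifies its constants BEFORE the label `(M, a)`, over a compact window
of subextremal labels, so the per-label d.o.c. localisation `stub_docLocalisation` has to hold
with one tolerance `δ` for all labels of a compact `K` and all far radii `R(ℓ)`, `R` continuous on
`K`, `r₊(ℓ) + η ≤ R(ℓ)`. This is a composition of two landed bricks: the label-uniform escape
fields (UE-1b) `stub_kerrEscapeFieldsContinuousU` on the bands `r₊(ℓ) + η ≤ r ≤ R(ℓ) + 2` give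
ONE triple `(m, ν, L)` of escape constants for all `ℓ ∈ K`, and the per-label localisation with
the escape fields as input (UD-of) `docLocalisation_of_escapeFields` has the explicit tolerance
`min 1 (m / (2 L²))`, which therefore serves every label. O'Neill 1983, Ch. 14 (chronological
relations); Dafermos–Rodnianski arXiv:0811.0354 §5.1 (`−g♯dt*` timelike); Kerr–Schild 1965, §3
(`r₊ = M + √(M² − a²)` continuous in the label).
-/

noncomputable section

-- the localisation lemma's 20-odd-argument application needs the deeper pending-instance search
set_option maxSynthPendingDepth 3

-- D-0017: single-problem summit, `Summit.<S>.<S>.…` by design (cf. lakefile `weak.linter.dupNamespace`).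
set_option linter.dupNamespace false

namespace Summit.FinalStateConjecture.FinalStateConjecture.Theorems

open Set Function Metric
open Literature.Geometry.Lorentzian Literature.Geometry.Lorentzian.MetricCoord
open scoped Manifold ContDiff Topology

/-- The outer horizon radius `r₊ = M + √(M² − a²)` is continuous in the label `(M, a)`
(Kerr–Schild 1965, §3; O'Neill 1995, §2.3). [cite: KerrSchild1965, §3] -/
private theorem stub_docLocalisationU_continuous_rPlus :
    Continuous fun ℓ : ℝ × ℝ => Kerr.rPlus ℓ.1 ℓ.2 := by
  unfold Kerr.rPlus
  fun_prop

/-- **Stub (UD) of the line `photon-shell-pseudoconvexity` (crux `GapExhaustion`,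
stmt-FinalStateConjecture-10808) — label-uniform localisation of the domain of outer
communications in near-Kerr charts. [folklore]** For a compact set `K ⊆ {(M, a) | 0 < M, |a| < M}`
of Kerr labels, `0 < η`, and far radii `R : ℝ × ℝ → ℝ` continuous on `K` with `r₊(ℓ) + η ≤ R(ℓ)`,
there is ONE `δ > 0` such that for every `ℓ = (M, a) ∈ K`, every spacetime `𝓢` and every chart
`Φ : E4 → 𝓢`, smooth with injective differential on `{r > M}`, whose pulled-back components are
`δ`-close to the Kerr–Schild form `g_{M,a}` in `C⁰` and `C¹` on the band `r₊ + η/2 ≤ r ≤ R(ℓ) + 2`,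
every point `z` with `r₊ + η ≤ r(z) ≤ R(ℓ)` satisfies `Φ z ∈ I⁻(Φ({r > R(ℓ)}))` for the time
orientation of `𝓢`. Composition of the label-uniform escape fields
`stub_kerrEscapeFieldsContinuousU` (bands `r₊(ℓ) + η ≤ r ≤ R(ℓ) + 2`) with the per-label
localisation `docLocalisation_of_escapeFields`, whose tolerance `min 1 (m / (2 L²))` depends on
the escape constants only (O'Neill 1983, Ch. 14; Dafermos–Rodnianski arXiv:0811.0354, §5.1). -/
theorem stub_docLocalisationU :
    ∀ (K : Set (ℝ × ℝ)) (η : ℝ) (R : ℝ × ℝ → ℝ), IsCompact K → (∀ ℓ ∈ K, 0 < ℓ.1 ∧ |ℓ.2| < ℓ.1) →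
      0 < η → ContinuousOn R K → (∀ ℓ ∈ K, Kerr.rPlus ℓ.1 ℓ.2 + η ≤ R ℓ) →
      ∃ δ : ℝ, 0 < δ ∧ ∀ ℓ ∈ K,
      ∀ (𝓢 : Spacetime.{0} 4) (Φ : E4 → 𝓢.carrier),
        ContMDiffOn 𝓘(ℝ, E4) (𝓡 4) ∞ Φ {z | ℓ.1 < Kerr.radius ℓ.2 z} →
        (∀ z : E4, ℓ.1 < Kerr.radius ℓ.2 z → Function.Injective (mfderiv 𝓘(ℝ, E4) (𝓡 4) Φ z)) →
        (∀ z : E4, Kerr.rPlus ℓ.1 ℓ.2 + η / 2 ≤ Kerr.radius ℓ.2 z → Kerr.radius ℓ.2 z ≤ R ℓ + 2 →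
          ‖𝓢.metricInCoords Φ z - Kerr.bilin ℓ.1 ℓ.2 z‖ ≤ δ ∧
          ‖fderiv ℝ (𝓢.metricInCoords Φ) z - fderiv ℝ (Kerr.bilin ℓ.1 ℓ.2) z‖ ≤ δ) →
        ∀ z : E4, Kerr.rPlus ℓ.1 ℓ.2 + η ≤ Kerr.radius ℓ.2 z → Kerr.radius ℓ.2 z ≤ R ℓ →
          Φ z ∈ 𝓢.metric.chronologicalPast 𝓢.timeOrientation
            (Φ '' {y | R ℓ < Kerr.radius ℓ.2 y}) := by
  intro K η R hK hlab hη hRc hR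
  -- the uniform escape fields on the bands `r₊(ℓ) + η ≤ r ≤ R(ℓ) + 2`
  have hloc : ContinuousOn (fun ℓ : ℝ × ℝ => Kerr.rPlus ℓ.1 ℓ.2 + η) K :=
    (stub_docLocalisationU_continuous_rPlus.continuousOn.add continuousOn_const)
  have hhic : ContinuousOn (fun ℓ : ℝ × ℝ => R ℓ + 2) K := hRc.add continuousOn_const
  have hband : ∀ ℓ ∈ K, Kerr.rPlus ℓ.1 ℓ.2 < Kerr.rPlus ℓ.1 ℓ.2 + η ∧
      Kerr.rPlus ℓ.1 ℓ.2 + η ≤ R ℓ + 2 := fun ℓ hℓ =>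
    ⟨lt_add_of_pos_right _ hη, by linarith [hR ℓ hℓ]⟩
  obtain ⟨m, ν, L, hm, hν, hL, hesc⟩ :=
    stub_kerrEscapeFieldsContinuousU K (fun ℓ => Kerr.rPlus ℓ.1 ℓ.2 + η) (fun ℓ => R ℓ + 2)
      hK hlab hloc hhic hband
  -- the tolerance depends on the escape constants `(m, L)` only
  refine ⟨min 1 (m / (2 * L ^ 2)), lt_min one_pos (by positivity), ?_⟩
  intro ℓ hℓ 𝓢 Φ hΦ hinj hclose z hzlo hzR
  obtain ⟨Y₁, Y₂, hY₁c, hY₂c, hY⟩ := hesc ℓ hℓ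
  exact docLocalisation_of_escapeFields ℓ.1 ℓ.2 η (R ℓ) m ν L Y₁ Y₂ (hlab ℓ hℓ).1 (hlab ℓ hℓ).2
    hη (hR ℓ hℓ) hm hν hL hY₁c hY₂c hY 𝓢 Φ hΦ hinj hclose z hzlo hzR

end Summit.FinalStateConjecture.FinalStateConjecture.Theorems

end
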